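import Summits.RiemannHypothesis.RiemannHypothesis.Theorems.NymanBeurlingDilateZeroSumPClosedForm
import Mathlib.Analysis.SpecialFunctions.Integrals.Basic
import HarnessLib

/-!
# RiemannHypothesis / Nyman–Beurling — the DILATE ZERO SUMS, III: the trivial-zero part
# `T(x)/x + 2x ∫_1^x T(t) t⁻³ dt = x(2 log 2 − 1) + Σ_{k≥0} x^{−(2k+2)}/((2k+2)(2k+3))` (RH-FREE)

Step III of the T7 programme (`NymanBeurlingDilateZeroSumIntegral.lean`, `…PClosedForm.lean`): the elementary series
and integrals of the trivial-zero series `T(x) = Σ_{k≥0} x^{−(2k+1)}/((2k+2)(2k+1))`: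
* `hasSum_one_div_even_mul_odd` — `Σ_{k≥0} 1/((2k+2)(2k+3)) = 1 − log 2`;
* `integral_trivTerm`, `hasSum_integral_trivTerm` — `∫_1^x T(t)t⁻³ dt = Σ_k (1 − x^{−(2k+3)})/((2k+1)(2k+2)(2k+3))`
  (term by term, dominated by `Σ 1/((2k+1)(2k+2))`);
* `trivBracket_eq` — the displayed identity;
* `hasSum_evenSeries_closed` — for `n ≥ 2`: `Σ_{k≥0} n^{−(2k+2)}/((2k+2)(2k+3)) = 1 − ½ log(1 − n⁻²) − (n/2) log((n+1)/(n−1))`.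
RH-FREE [rh-li-eng-3 g5]: elementary real analysis; nothing here bears on the truth of RH.
-/

noncomputable section

set_option linter.dupNamespace false

open Filter Set MeasureTheory Topology intervalIntegral
open scoped Real

namespace Summit.RiemannHypothesis.RiemannHypothesis.Theorems.NbTheory

open Literature.NumberTheory.LFunctions

namespace DilateExplicit

/-! ## `Σ_{k≥0} 1/((2k+2)(2k+3)) = 1 − log 2` -/

/-- Telescoping: `Σ_{k<K} (1/(2k+1) − 1/(2k+3)) = 1 − 1/(2K+1)`. -/
lemma sum_range_telescope (K : ℕ) :
    ∑ k ∈ Finset.range K, (1 / (2 * (k : ℝ) + 1) - 1 / (2 * k + 3)) = 1 - 1 / (2 * K + 1) := by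
  induction K with
  | zero => simp
  | succ K ih =>
    rw [Finset.sum_range_succ, ih]
    push_cast
    have h1 : (2 * (K : ℝ) + 1) ≠ 0 := by positivity
    have h2 : (2 * (K : ℝ) + 3) ≠ 0 := by positivity
    have h3 : (2 * ((K : ℝ) + 1) + 1) ≠ 0 := by positivity
    field_simp
    ring

/-- `Σ_{k≥0} (1/(2k+1) − 1/(2k+3)) = 1`. -/
lemma hasSum_telescope : HasSum (fun k : ℕ ↦ 1 / (2 * (k : ℝ) + 1) - 1 / (2 * k + 3)) 1 := by
  refine (hasSum_iff_tendsto_nat_of_nonneg (fun k ↦ ?_) _).2 ?_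
  · rw [sub_nonneg]
    exact one_div_le_one_div_of_le (by positivity) (by linarith)
  · have h : Tendsto (fun K : ℕ ↦ (1 : ℝ) - 1 / (2 * K + 1)) atTop (𝓝 (1 - 0)) := by
      refine tendsto_const_nhds.sub ?_
      have h1 : Tendsto (fun K : ℕ ↦ 2 * (K : ℝ) + 1) atTop atTop :=
        tendsto_atTop_add_const_right _ _ (tendsto_natCast_atTop_atTop.const_mul_atTop two_pos)
      refine (h1.inv_tendsto_atTop).congr fun K ↦ ?_
      simp only [Pi.inv_apply, one_div]
    rw [sub_zero] at h
    exact h.congr fun K ↦ (sum_range_telescope K).symm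

/-- **`Σ_{k≥0} 1/((2k+2)(2k+3)) = 1 − log 2`** (since `1/((2k+1)(2k+2)) + 1/((2k+2)(2k+3)) = 1/(2k+1) − 1/(2k+3)`). -/
theorem hasSum_one_div_even_mul_odd :
    HasSum (fun k : ℕ ↦ 1 / ((2 * (k : ℝ) + 2) * (2 * k + 3))) (1 - Real.log 2) := by
  have h := hasSum_telescope.sub hasSum_one_div_odd_mul_even
  refine h.congr_fun fun k ↦ ?_
  have h1 : (2 * (k : ℝ) + 1) ≠ 0 := by positivity
  have h2 : (2 * (k : ℝ) + 2) ≠ 0 := by positivity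
  have h3 : (2 * (k : ℝ) + 3) ≠ 0 := by positivity
  field_simp
  ring

/-! ## `∫_1^x T(t) t⁻³ dt` term by term -/

/-- The termwise integral: `∫_1^x t^{−(2k+1)}/((2k+2)(2k+1)) · t⁻³ dt = (1 − x^{−(2k+3)})/((2k+3)(2k+2)(2k+1))`. -/
theorem integral_trivTerm {x : ℝ} (hx : 1 ≤ x) (k : ℕ) :
    ∫ t in (1 : ℝ)..x, t ^ (-(2 * (k : ℝ) + 1)) / ((2 * k + 2) * (2 * k + 1)) / t ^ 3 =
      (1 - x ^ (-(2 * (k : ℝ) + 3))) / ((2 * k + 3) * ((2 * k + 2) * (2 * k + 1))) := by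
  have hcongr : ∫ t in (1 : ℝ)..x, t ^ (-(2 * (k : ℝ) + 1)) / ((2 * k + 2) * (2 * k + 1)) / t ^ 3 =
      ∫ t in (1 : ℝ)..x, 1 / ((2 * (k : ℝ) + 2) * (2 * k + 1)) * t ^ (-(2 * (k : ℝ) + 4)) := by
    refine intervalIntegral.integral_congr fun t ht ↦ ?_
    rw [Set.uIcc_of_le hx] at ht
    have ht0 : 0 < t := by linarith [ht.1]
    have h3 : t ^ 3 = t ^ (3 : ℝ) := by norm_cast
    rw [h3, div_div, mul_comm ((2 * (k : ℝ) + 2) * (2 * k + 1)), ← div_div, ← Real.rpow_sub ht0]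
    rw [show (-(2 * (k : ℝ) + 1) - 3) = -(2 * (k : ℝ) + 4) by ring]
    ring
  have hr : (-(2 * (k : ℝ) + 4)) ≠ -1 ∧ (0 : ℝ) ∉ Set.uIcc (1 : ℝ) x := by
    constructor
    · intro h
      have hk := (k.cast_nonneg : (0 : ℝ) ≤ k)
      linarith
    · rw [Set.uIcc_of_le hx]
      intro h; exact absurd h.1 (by norm_num)
  rw [hcongr, intervalIntegral.integral_const_mul, integral_rpow (Or.inr hr), Real.one_rpow]
  have e1 : -(2 * (k : ℝ) + 4) + 1 = -(2 * (k : ℝ) + 3) := by ring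
  rw [e1]
  have h1 : (2 * (k : ℝ) + 1) ≠ 0 := by positivity
  have h2 : (2 * (k : ℝ) + 2) ≠ 0 := by positivity
  have h3 : (2 * (k : ℝ) + 3) ≠ 0 := by positivity
  have h4 : (-(2 * (k : ℝ) + 3)) ≠ 0 := by intro h; apply h3; linarith
  field_simp
  ring

/-- **Term-by-term integration of `T(t)t⁻³` on `[1, x]`** (dominated by `Σ 1/((2k+1)(2k+2))`). -/
theorem hasSum_integral_trivTerm {x : ℝ} (hx : 1 ≤ x) :
    HasSum (fun k : ℕ ↦ ∫ t in (1 : ℝ)..x, t ^ (-(2 * (k : ℝ) + 1)) / ((2 * k + 2) * (2 * k + 1)) / t ^ 3)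
      (∫ t in (1 : ℝ)..x, (∑' k : ℕ, t ^ (-(2 * (k : ℝ) + 1)) / ((2 * k + 2) * (2 * k + 1))) / t ^ 3) := by
  have hI : Set.uIoc (1 : ℝ) x = Set.Ioc 1 x := Set.uIoc_of_le hx
  refine intervalIntegral.hasSum_integral_of_dominated_convergence
    (fun k _ ↦ 1 / ((2 * (k : ℝ) + 1) * (2 * k + 2))) ?_ ?_ ?_ ?_ ?_
  · intro k
    rw [hI]
    refine ContinuousOn.aestronglyMeasurable ?_ measurableSet_Ioc
    refine ContinuousOn.div ?_ (by fun_prop) fun t ht ↦ by have : 0 < t := by linarith [ht.1]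
                                                           positivity
    refine ContinuousOn.div_const (ContinuousOn.rpow_const continuousOn_id fun t ht ↦ ?_) _
    exact Or.inl (by simp only [id]; linarith [ht.1])
  · intro k
    refine ae_of_all _ fun t ht ↦ ?_
    rw [hI] at ht
    have ht1 : 1 ≤ t := ht.1.le
    have ht0 : 0 < t := by linarith
    have h3 : 1 ≤ t ^ 3 := one_le_pow₀ ht1
    rw [Real.norm_eq_abs, abs_of_nonneg (by positivity)]
    calc t ^ (-(2 * (k : ℝ) + 1)) / ((2 * k + 2) * (2 * k + 1)) / t ^ 3
        ≤ t ^ (-(2 * (k : ℝ) + 1)) / ((2 * k + 2) * (2 * k + 1)) / 1 :=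
          div_le_div_of_nonneg_left (by positivity) one_pos h3
      _ = t ^ (-(2 * (k : ℝ) + 1)) / ((2 * k + 2) * (2 * k + 1)) := div_one _
      _ ≤ 1 / ((2 * (k : ℝ) + 1) * (2 * k + 2)) := trivTerm_le ht1 k
  · exact ae_of_all _ fun t _ ↦ summable_one_div_odd_mul_even
  · exact intervalIntegrable_const
  · refine ae_of_all _ fun t ht ↦ ?_
    rw [hI] at ht
    exact (summable_trivTerm ht.1.le).hasSum.div_const _

/-! ## The trivial-zero bracket -/

/-- Summability of `x^{−(2k+2)}/((2k+2)(2k+3))` for `x ≥ 1`. -/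
lemma summable_evenTerm {x : ℝ} (hx : 1 ≤ x) :
    Summable fun k : ℕ ↦ x ^ (-(2 * (k : ℝ) + 2)) / ((2 * k + 2) * (2 * k + 3)) := by
  refine Summable.of_nonneg_of_le (fun k ↦ ?_) (fun k ↦ ?_) hasSum_one_div_even_mul_odd.summable
  · have : 0 < x := by linarith
    positivity
  · have h1 : x ^ (-(2 * (k : ℝ) + 2)) ≤ 1 :=
      Real.rpow_le_one_of_one_le_of_nonpos hx (by nlinarith [(k.cast_nonneg : (0 : ℝ) ≤ k)])
    calc x ^ (-(2 * (k : ℝ) + 2)) / ((2 * k + 2) * (2 * k + 3)) ≤ 1 / ((2 * (k : ℝ) + 2) * (2 * k + 3)) :=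
          div_le_div_of_nonneg_right h1 (by positivity)
      _ = 1 / ((2 * (k : ℝ) + 2) * (2 * k + 3)) := rfl

/-- **THE TRIVIAL-ZERO BRACKET (RH-FREE):** for `x ≥ 1`,
`T(x)/x + 2x ∫_1^x T(t) t⁻³ dt = x(2 log 2 − 1) + Σ_{k≥0} x^{−(2k+2)}/((2k+2)(2k+3))`. -/
theorem trivBracket_eq {x : ℝ} (hx : 1 ≤ x) :
    (∑' k : ℕ, x ^ (-(2 * (k : ℝ) + 1)) / ((2 * k + 2) * (2 * k + 1))) / x +
        2 * x * ∫ t in (1 : ℝ)..x, (∑' k : ℕ, t ^ (-(2 * (k : ℝ) + 1)) / ((2 * k + 2) * (2 * k + 1))) / t ^ 3 =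
      x * (2 * Real.log 2 - 1) + ∑' k : ℕ, x ^ (-(2 * (k : ℝ) + 2)) / ((2 * k + 2) * (2 * k + 3)) := by
  have hx0 : x ≠ 0 := by linarith
  -- left-hand side as one series
  have hL : HasSum (fun k : ℕ ↦ x ^ (-(2 * (k : ℝ) + 1)) / ((2 * k + 2) * (2 * k + 1)) / x +
      2 * x * ((1 - x ^ (-(2 * (k : ℝ) + 3))) / ((2 * k + 3) * ((2 * k + 2) * (2 * k + 1)))))
      ((∑' k : ℕ, x ^ (-(2 * (k : ℝ) + 1)) / ((2 * k + 2) * (2 * k + 1))) / x +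
        2 * x * ∫ t in (1 : ℝ)..x, (∑' k : ℕ, t ^ (-(2 * (k : ℝ) + 1)) / ((2 * k + 2) * (2 * k + 1))) / t ^ 3) := by
    have h1 := ((summable_trivTerm hx).hasSum.div_const x)
    have h2 := (hasSum_integral_trivTerm hx).mul_left (2 * x)
    have h2' : HasSum (fun k : ℕ ↦ 2 * x * ((1 - x ^ (-(2 * (k : ℝ) + 3))) / ((2 * k + 3) * ((2 * k + 2) * (2 * k + 1)))))
        (2 * x * ∫ t in (1 : ℝ)..x, (∑' k : ℕ, t ^ (-(2 * (k : ℝ) + 1)) / ((2 * k + 2) * (2 * k + 1))) / t ^ 3) :=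
      h2.congr_fun fun k ↦ by simp only [integral_trivTerm hx k]
    exact h1.add h2'
  -- right-hand side as one series
  have hR : HasSum (fun k : ℕ ↦ x * (1 / ((2 * (k : ℝ) + 1) * (2 * k + 2)) - 1 / ((2 * (k : ℝ) + 2) * (2 * k + 3))) +
      x ^ (-(2 * (k : ℝ) + 2)) / ((2 * k + 2) * (2 * k + 3)))
      (x * (Real.log 2 - (1 - Real.log 2)) + ∑' k : ℕ, x ^ (-(2 * (k : ℝ) + 2)) / ((2 * k + 2) * (2 * k + 3))) :=
    ((hasSum_one_div_odd_mul_even.sub hasSum_one_div_even_mul_odd).mul_left x).add (summable_evenTerm hx).hasSum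
  rw [show x * (2 * Real.log 2 - 1) = x * (Real.log 2 - (1 - Real.log 2)) by ring]
  have hR' : HasSum (fun k : ℕ ↦ x ^ (-(2 * (k : ℝ) + 1)) / ((2 * k + 2) * (2 * k + 1)) / x +
      2 * x * ((1 - x ^ (-(2 * (k : ℝ) + 3))) / ((2 * k + 3) * ((2 * k + 2) * (2 * k + 1)))))
      (x * (Real.log 2 - (1 - Real.log 2)) + ∑' k : ℕ, x ^ (-(2 * (k : ℝ) + 2)) / ((2 * k + 2) * (2 * k + 3))) := by
    refine hR.congr_fun fun k ↦ ?_
    -- termwise algebra: powers `x^{−(2k+1)}/x = x^{−(2k+2)} = x · x^{−(2k+3)}`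
    have e1 : x ^ (-(2 * (k : ℝ) + 1)) = x ^ (-(2 * (k : ℝ) + 2)) * x := by
      rw [← Real.rpow_add_one hx0]; congr 1; ring
    have e2 : x ^ (-(2 * (k : ℝ) + 3)) = x ^ (-(2 * (k : ℝ) + 2)) / x := by
      rw [← Real.rpow_sub_one hx0]; congr 1; ring
    have h1 : (2 * (k : ℝ) + 1) ≠ 0 := by positivity
    have h2 : (2 * (k : ℝ) + 2) ≠ 0 := by positivity
    have h3 : (2 * (k : ℝ) + 3) ≠ 0 := by positivity
    rw [e1, e2]
    field_simp
    ring
  exact hL.unique hR'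

/-! ## The even series in closed form: `Σ_{k≥0} x^{−(2k+2)}/((2k+2)(2k+3))`, `x > 1` -/

/-- **Closed form (RH-FREE, elementary):** for `x > 1`,
`Σ_{k≥0} x^{−(2k+2)}/((2k+2)(2k+3)) = 1 − ½ log(1 − 1/x²) − (x/2) log((x+1)/(x−1))`
(`Σ y^{2k+2}/(2k+2) = −½ log(1−y²)`, `Σ y^{2k+1}/(2k+1) = ½ log((1+y)/(1−y))`, `y = 1/x`). -/
theorem hasSum_evenSeries_closed {x : ℝ} (hx : 1 < x) :
    HasSum (fun k : ℕ ↦ x ^ (-(2 * (k : ℝ) + 2)) / ((2 * k + 2) * (2 * k + 3)))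
      (1 - 1 / 2 * Real.log (1 - 1 / x ^ 2) - x / 2 * Real.log ((x + 1) / (x - 1))) := by
  have hx0 : 0 < x := by linarith
  set y : ℝ := x⁻¹ with hy
  have hy0 : 0 < y := inv_pos.2 hx0
  have hy1 : y < 1 := inv_lt_one_of_one_lt₀ hx
  have hyabs : |y| < 1 := by rw [abs_of_pos hy0]; exact hy1
  have hy2abs : |y ^ 2| < 1 := by
    rw [abs_of_nonneg (sq_nonneg y)]; nlinarith
  -- (a) `Σ y^{2k+2}/(2k+2) = −½ log(1 − y²)`
  have hA : HasSum (fun k : ℕ ↦ y ^ (2 * k + 2) / (2 * k + 2)) (-(1 / 2) * Real.log (1 - y ^ 2)) := by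
    have h := (Real.hasSum_pow_div_log_of_abs_lt_one hy2abs).mul_left (1 / 2)
    rw [show 1 / 2 * -Real.log (1 - y ^ 2) = -(1 / 2) * Real.log (1 - y ^ 2) by ring] at h
    refine h.congr_fun fun k ↦ ?_
    rw [← pow_mul, show 2 * (k + 1) = 2 * k + 2 by ring]
    have : (2 * (k : ℝ) + 2) ≠ 0 := by positivity
    field_simp
  -- (b) `Σ y^{2k+2}/(2k+3) = (½ (log(1+y) − log(1−y)) − y)/y`
  have hB0 : HasSum (fun k : ℕ ↦ y ^ (2 * k + 1) / (2 * k + 1))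
      (1 / 2 * (Real.log (1 + y) - Real.log (1 - y))) := by
    have h := (Real.hasSum_log_sub_log_of_abs_lt_one hyabs).mul_left (1 / 2)
    refine h.congr_fun fun k ↦ ?_
    have : (2 * (k : ℝ) + 1) ≠ 0 := by positivity
    field_simp
  have hB1 : HasSum (fun k : ℕ ↦ y ^ (2 * (k + 1) + 1) / (2 * ((k + 1 : ℕ) : ℝ) + 1))
      (1 / 2 * (Real.log (1 + y) - Real.log (1 - y)) - y) := by
    have h := (hasSum_nat_add_iff' (f := fun k : ℕ ↦ y ^ (2 * k + 1) / (2 * k + 1)) 1).2 hB0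
    simp only [Finset.range_one, Finset.sum_singleton, Nat.cast_zero, mul_zero, zero_add, pow_one, div_one] at h
    exact h
  have hB : HasSum (fun k : ℕ ↦ y ^ (2 * k + 2) / (2 * k + 3))
      ((1 / 2 * (Real.log (1 + y) - Real.log (1 - y)) - y) / y) := by
    have h := hB1.div_const y
    refine h.congr_fun fun k ↦ ?_
    push_cast
    rw [show 2 * (k + 1) + 1 = (2 * k + 2) + 1 by ring, pow_succ]
    have : (2 * ((k : ℝ) + 1) + 1) = 2 * k + 3 := by ring
    rw [this]
    field_simp
    ring
  -- (c) combine
  have hC := hA.sub hB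
  have hval : -(1 / 2) * Real.log (1 - y ^ 2) - (1 / 2 * (Real.log (1 + y) - Real.log (1 - y)) - y) / y =
      1 - 1 / 2 * Real.log (1 - 1 / x ^ 2) - x / 2 * Real.log ((x + 1) / (x - 1)) := by
    have e1 : y ^ 2 = 1 / x ^ 2 := by rw [hy, inv_pow, one_div]
    have e2 : Real.log (1 + y) - Real.log (1 - y) = Real.log ((x + 1) / (x - 1)) := by
      have hp : 0 < 1 + y := by linarith
      have hm : 0 < 1 - y := by linarith
      rw [← Real.log_div hp.ne' hm.ne']
      congr 1
      rw [hy]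
      field_simp
    rw [e1, e2, hy]
    field_simp
    ring
  rw [← hval]
  refine hC.congr_fun fun k ↦ ?_
  have epow : x ^ (-(2 * (k : ℝ) + 2)) = y ^ (2 * k + 2) := by
    rw [hy, Real.rpow_neg hx0.le, show (2 * (k : ℝ) + 2) = ((2 * k + 2 : ℕ) : ℝ) by push_cast; ring,
      Real.rpow_natCast, inv_pow]
  rw [epow]
  have h2 : (2 * (k : ℝ) + 2) ≠ 0 := by positivity
  have h3 : (2 * (k : ℝ) + 3) ≠ 0 := by positivity
  field_simp
  ring
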